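import Summits.QuantumFields.BalabanUV.T4Continuum.Support.RegionCornerCoupling
import Summits.QuantumFields.BalabanUV.T4Continuum.Support.RegionGaugeResolventSplit

/-!
# T⁴ programme, spine node NE2 (U1a), sub-row Δ1 «NE2⁰-Dirichlet» — THE DICTIONARY DELTA AS AN OPERATOR IDENTITY: the LITERAL compression of
# the torus vector Laplace operator to the star bonds versus the tree's (electric) local operator —
# `Ω₀ΔΩ₀|_star = Δ_loc(0) + E·Eᴴ = Σ_μ W_μ + n²·diag([head ∉ Ω] + [tail ∉ Ω])` (`2 ≤ n`): NO corner coupling, a boundary-normal MASS instead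

NE2 formalisation swarm `b2b-balaban-t4-ne2-formalise-*`, LEAF PROVER 02 (gen 9), support item «Δ1-CORNER-COUPLING», file 6 (typed input for the
row-NE2 owner's gen-16 ITEM 1 = the dictionary fork GAPS G-ne2p1-g15-6, ruling R44 (c): [B9] p.394–395 «`Δ_a` with Dirichlet boundary conditions on
`Ω₀ᶜ`, thus `Δ_a|Ω₀ = Ω₀Δ_aΩ₀`» (3.27) is a COMPRESSION of the torus operator and keeps the exterior divergence, whereas the tree's `regionDeltaA` /
`regionDeltaLoc` build the divergence part from `gradR = (∂)_{V,Ω}` and so DROP the exterior flux — the electric boundary condition behind both the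
free-end `(√L)⁻¹` rate on boxes and the corner blow-up measured by leaf-07-g10, `t4/T4-EST-NE2-D1-REENTRANT.md`).  THIS FILE types the delta between
the two readings at `U = 1`, mass `0`, on the STAR bonds `V` of ANY union of blocks:

 * §1 **`gradGram_submatrix`** `(∂∂ᴴ)_{VV} = ∂_Ω∂_Ωᴴ + E·Eᴴ` (the columns of `∂ᴴ` split at `∂Ω`; `E = extGrad`), hence
   **`Lap_submatrix_eq_loc_add_extGram`**: `(Lap)_{VV} = regionDeltaLoc n M 0 S + E·Eᴴ` (via gen 5's `curlRᴴcurlR = (Lap − ∂∂ᴴ)_{VV}`), and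
   `extGram_eq_diag_sub_cornerC`: `E·Eᴴ = diag(n²·cnt1 (b.2) b) − C` (gen 8's `cornerC` by definition).
 * §2 the literal compression is COMPONENTWISE DIRICHLET: **`Lap_submatrix_eq_sum_toBlock`** `(Lap)_{VV} = Σ_μ ((∇_μ)ᴴ∇_μ)_{VV}`
   `= Σ_μ (Idiff_μᴴ·Idiff_μ + n²·diag(cnt1 μ))` (gen 8's `toBlock_fdiff_sq`), and its zero-extension W2 holds with constant ONE on every region
   (**`re_form_Lap_submatrix`** `re⟨A, (Lap)_{VV}A⟩ = Σ_ν ‖∇_ν ιA‖²`); the two forms differ by `extFlux A ≥ 0` (`re_form_Lap_submatrix_eq_loc_add_extFlux`,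
   sandwich `re_form_Lap_submatrix_sandwich` at `2 ≤ n`).
 * §3 THE DELTA: **`Lap_submatrix_sub_loc`** `(Lap)_{VV} − Δ_loc(0) = diag(n²·cnt1 (b.2) b) − C` (any `n`), and at `2 ≤ n`
   (`cnt1 (b.2) b = bdW 1 b`, file 2) **`Lap_submatrix_eq_dir_add_bdMass`** `(Lap)_{VV} = Σ_μ W_μ + diag(n²·bdW 1)`: against the electric
   `Δ_loc(0) = Σ_μ W_μ + C` (file 6 of gen 8, `electric_general`) the literal operator trades the corner coupling `C` (indefinite, `‖C‖ ≤ (d−1)n²`,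
   supported on the corner bonds) for a MASS `n²` on every star bond crossing `∂Ω` (positive, diagonal) — which pins the free normal component.
   (On the CLOSED bonds — both endpoints in `Ω` — the rows of `E` vanish, so both operators have the SAME principal sub-block there: the two readings
   differ only through the star bonds crossing `∂Ω`; prose.)

HONEST FRAMING (T4-DAG p. 1).  Lattice bookkeeping at MODEL level (`U = 1`, ONE region, finite torus, mass and gauge terms stripped); statements OURS
([folklore]); this file DECIDES NOTHING about which reading is [B9]'s (trigger c5: the B0 dictionary is b05/an2's) — it only types the difference; no
tower / two-level law is claimed for either operator; Δ1 NOT closed; NE2 (U1a) NOT proved; spine PROVED 0/9 unchanged; NOT [B9] (3.16)/(3.23)–(3.27) as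
printed; NOT infinite volume, NOT a mass gap, NOT the Clay problem.  HONEST DEPENDENCY: continuum YM on T⁴ ⇐ BetaPertH ∧ nine spine estimates (0/9
proved); BetaPertH ⇐ (D1) ∧ (D4) ∧ CAP+tail; G-an2-4 gates asym, D1 and NE2/3/4.  No `sorry`.
-/

noncomputable section

open scoped BigOperators ComplexConjugate Matrix Matrix.Norms.L2Operator
open Finset

namespace Summit.QuantumFields.BalabanUV.T4Continuum.RegionLiteralCompression

open Literature.MathematicalPhysics.QuantumFieldTheory.Balaban1983to89.B5Prop11Plancherel (Tor fine fdiff unitVec)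
open Literature.MathematicalPhysics.QuantumFieldTheory.Balaban1983to89.B5Prop11Lower (Lap nsq)
open Literature.MathematicalPhysics.QuantumFieldTheory.Balaban1983to89.B5Action121 (GradOp)
open Summit.QuantumFields.BalabanUV.T4Continuum
open Summit.QuantumFields.BalabanUV.T4Continuum.SubtypeCompression (ext form_toBlock)
open Summit.QuantumFields.BalabanUV.T4Continuum.RegionGaugeTwoZoneTransfer (re_form_Lap_eq)
open Summit.QuantumFields.BalabanUV.T4Continuum.RegionGaugeFixedVector (starReg curlR gradR avgR curlR_conjTranspose_mul_curlR)
open Summit.QuantumFields.BalabanUV.T4Continuum.RegionElectricSplitting (Idiff cnt1 Wdir toBlock_fdiff_sq sum_tcnt_eq cntR_eq_sum_cnt1)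
open Summit.QuantumFields.BalabanUV.T4Continuum.RegionGaffneyIdentity (extFlux extFlux_nonneg)
open Summit.QuantumFields.BalabanUV.T4Continuum.RegionElectricGeneral (extGrad cornerC electric_general form_extGram)
open Summit.QuantumFields.BalabanUV.T4Continuum.RegionExteriorFlux (bdW)
open Summit.QuantumFields.BalabanUV.T4Continuum.RegionCornerCoupling (cnt1_own_eq_bdW extFlux_le_boundary)
open Summit.QuantumFields.BalabanUV.T4Continuum.RegionGaugeResolventSplit (regionDeltaLoc regionDeltaLoc_eq)
open Summit.QuantumFields.BalabanUV.Beta.GAN24.DirichletBoxTrace (blockReg)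

variable {d : ℕ}

section Region

variable (n : ℕ) [NeZero n] (M : Fin d → ℕ) [hM : ∀ μ, NeZero (M μ)] (S : Tor M → Prop) [DecidablePred S]

/-! ## §1 The literal compression against the electric local operator -/

/-- **`(∂∂ᴴ)_{VV} = ∂_Ω∂_Ωᴴ + E·Eᴴ`**: the columns of the torus divergence split into the sites of `Ω` and the exterior sites. [folklore] -/
theorem gradGram_submatrix :
    (GradOp (fine n M) (n : ℂ) * (GradOp (fine n M) (n : ℂ))ᴴ).submatrix (Subtype.val : {b // starReg n M S b} → _) Subtype.val
      = gradR n M S * (gradR n M S)ᴴ + extGrad n M S * (extGrad n M S)ᴴ := by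
  ext b b'
  simp only [Matrix.submatrix_apply, Matrix.add_apply, Matrix.mul_apply, Matrix.conjTranspose_apply, gradR, extGrad, Matrix.toBlock_apply]
  exact (Fintype.sum_subtype_add_sum_subtype (blockReg n M S)
    (fun y => GradOp (fine n M) (n : ℂ) b.1 y * star (GradOp (fine n M) (n : ℂ) b'.1 y))).symm

/-- **THE LITERAL COMPRESSION IS THE ELECTRIC LOCAL OPERATOR PLUS THE EXTERIOR GRAM BLOCK**: `(Lap)_{VV} = regionDeltaLoc n M 0 S + E·Eᴴ`
(any union of blocks, any `n`). [cite: Balaban1985BackgroundPropagators, (3.27) p.395 (shape: Ω₀Δ_aΩ₀)] [folklore] -/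
theorem Lap_submatrix_eq_loc_add_extGram :
    (Lap n M).submatrix (Subtype.val : {b // starReg n M S b} → _) Subtype.val
      = regionDeltaLoc n M 0 S + extGrad n M S * (extGrad n M S)ᴴ := by
  have h := curlR_conjTranspose_mul_curlR n M S
  rw [Matrix.submatrix_sub, Pi.sub_apply, Pi.sub_apply, gradGram_submatrix] at h
  rw [regionDeltaLoc_eq, zero_mul, Complex.ofReal_zero, zero_smul, add_zero, h]
  abel

/-- the exterior Gram block through gen 8's corner coupling: `E·Eᴴ = diag(n²·cnt1 (b.2) b) − C` (definition of `cornerC`). [folklore] -/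
theorem extGram_eq_diag_sub_cornerC :
    extGrad n M S * (extGrad n M S)ᴴ
      = Matrix.diagonal (fun b : {b // starReg n M S b} => (((n : ℝ) ^ 2 * cnt1 n M S b.1.2 b.1 : ℝ) : ℂ)) - cornerC n M S := by
  rw [cornerC, sub_sub_cancel]

/-! ## §2 The literal compression is componentwise Dirichlet -/

omit [DecidablePred S] in
/-- **`(Lap)_{VV} = Σ_μ ((∇_μ)ᴴ∇_μ)_{VV}`** — direction by direction (no coupling of directions or components at all). [folklore] -/
theorem Lap_submatrix_eq_sum_toBlock :
    (Lap n M).submatrix (Subtype.val : {b // starReg n M S b} → _) Subtype.val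
      = ∑ μ, ((fdiff (fine n M) (n : ℂ) μ)ᴴ * fdiff (fine n M) (n : ℂ) μ).toBlock (starReg n M S) (starReg n M S) := by
  ext b b'
  simp only [Lap, Matrix.submatrix_apply, Matrix.sum_apply, Matrix.toBlock_apply]

/-- … each direction being the INTERIOR difference plus the Dirichlet charge of BOTH translates:
`(Lap)_{VV} = Σ_μ (Idiff_μᴴ·Idiff_μ + n²·diag(cnt1 μ))` (gen 8's `toBlock_fdiff_sq`). [folklore] -/
theorem Lap_submatrix_eq_sum_dirichlet :
    (Lap n M).submatrix (Subtype.val : {b // starReg n M S b} → _) Subtype.val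
      = ∑ μ, ((Idiff n M S μ)ᴴ * Idiff n M S μ
          + Matrix.diagonal (fun b : {b // starReg n M S b} => (((n : ℝ) ^ 2 * cnt1 n M S μ b.1 : ℝ) : ℂ))) := by
  rw [Lap_submatrix_eq_sum_toBlock]
  exact sum_congr rfl fun μ _ => toBlock_fdiff_sq n M S μ

/-- **HENCE THE ZERO-EXTENSION W2 OF THE LITERAL OPERATOR HOLDS WITH CONSTANT ONE** on every union of blocks and every `n`:
`re⟨A, (Lap)_{VV} A⟩ = Σ_ν ‖∇_ν ιA‖²` (the literal compression CONTAINS the full Dirichlet energy of the zero extension; for the electric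
`Δ_loc` the same quantity exceeds the form by `extFlux A`, gen 6's `gaffney_region`). [folklore] -/
theorem re_form_Lap_submatrix (A : {b // starReg n M S b} → ℂ) :
    (star A ⬝ᵥ ((Lap n M).submatrix (Subtype.val : {b // starReg n M S b} → _) Subtype.val *ᵥ A)).re
      = ∑ ν, nsq (fdiff (fine n M) (n : ℂ) ν *ᵥ ext (starReg n M S) A) := by
  rw [show (Lap n M).submatrix (Subtype.val : {b // starReg n M S b} → _) Subtype.val = (Lap n M).toBlock (starReg n M S) (starReg n M S)
    from rfl, form_toBlock, re_form_Lap_eq]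

/-- the two FORMS differ by the exterior flux: `re⟨A, (Lap)_{VV}A⟩ = re⟨A, Δ_loc(0)A⟩ + extFlux A` (any `n`; gen 6's Gaffney identity in operator
clothing), so the literal form DOMINATES the electric one, and by file 2's `extFlux_le_boundary` exceeds it by at most `d·n²·Σ_∂‖A‖²` at `2 ≤ n`.
[folklore] -/
theorem re_form_Lap_submatrix_eq_loc_add_extFlux (A : {b // starReg n M S b} → ℂ) :
    (star A ⬝ᵥ ((Lap n M).submatrix (Subtype.val : {b // starReg n M S b} → _) Subtype.val *ᵥ A)).re
      = (star A ⬝ᵥ (regionDeltaLoc n M 0 S *ᵥ A)).re + extFlux n M S A := by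
  rw [Lap_submatrix_eq_loc_add_extGram, Matrix.add_mulVec, dotProduct_add, Complex.add_re, form_extGram, Complex.ofReal_re]

/-- the sandwich at `2 ≤ n`: `re⟨A, Δ_loc(0)A⟩ ≤ re⟨A, (Lap)_{VV}A⟩ ≤ re⟨A, Δ_loc(0)A⟩ + d·n²·Σ_y bdW 1 y·‖A y‖²`. [folklore] -/
theorem re_form_Lap_submatrix_sandwich (hn : 2 ≤ n) (A : {b // starReg n M S b} → ℂ) :
    (star A ⬝ᵥ (regionDeltaLoc n M 0 S *ᵥ A)).re
        ≤ (star A ⬝ᵥ ((Lap n M).submatrix (Subtype.val : {b // starReg n M S b} → _) Subtype.val *ᵥ A)).re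
      ∧ (star A ⬝ᵥ ((Lap n M).submatrix (Subtype.val : {b // starReg n M S b} → _) Subtype.val *ᵥ A)).re
        ≤ (star A ⬝ᵥ (regionDeltaLoc n M 0 S *ᵥ A)).re
          + (d : ℝ) * (n : ℝ) ^ 2 * ∑ y : {b // starReg n M S b}, bdW n M S (fun _ => 1) y.1 * ‖A y‖ ^ 2 := by
  rw [re_form_Lap_submatrix_eq_loc_add_extFlux]
  exact ⟨le_add_of_nonneg_right (extFlux_nonneg n M S A), by have := extFlux_le_boundary n M S hn A; linarith⟩

/-! ## §3 The delta -/

/-- **THE DELTA, ANY `n`**: `(Lap)_{VV} − Δ_loc(0) = diag(n²·cnt1 (b.2) b) − C`. [folklore] -/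
theorem Lap_submatrix_sub_loc :
    (Lap n M).submatrix (Subtype.val : {b // starReg n M S b} → _) Subtype.val - regionDeltaLoc n M 0 S
      = Matrix.diagonal (fun b : {b // starReg n M S b} => (((n : ℝ) ^ 2 * cnt1 n M S b.1.2 b.1 : ℝ) : ℂ)) - cornerC n M S := by
  rw [Lap_submatrix_eq_loc_add_extGram, add_sub_cancel_left, extGram_eq_diag_sub_cornerC]

/-- **THE DELTA AT `2 ≤ n`: LITERAL = COMPONENTWISE PIECES + A BOUNDARY-NORMAL MASS** — `(Lap)_{VV} = Σ_μ W_μ + diag(n²·bdW 1)`,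
`bdW 1 b = [head ∉ Ω] + [tail ∉ Ω]`; against the electric `Δ_loc(0) = Σ_μ W_μ + C` (`electric_general`): no corner coupling, and a mass `n²` on
every star bond crossing `∂Ω`. [folklore] -/
theorem Lap_submatrix_eq_dir_add_bdMass (hn : 2 ≤ n) :
    (Lap n M).submatrix (Subtype.val : {b // starReg n M S b} → _) Subtype.val
      = ∑ μ, Wdir n M S μ + Matrix.diagonal (fun b : {b // starReg n M S b} => (((n : ℝ) ^ 2 * bdW n M S (fun _ => 1) b.1 : ℝ) : ℂ)) := by
  have h := Lap_submatrix_sub_loc n M S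
  rw [sub_eq_iff_eq_add] at h
  rw [h, regionDeltaLoc_eq, zero_mul, Complex.ofReal_zero, zero_smul, add_zero, electric_general]
  have e : Matrix.diagonal (fun b : {b // starReg n M S b} => (((n : ℝ) ^ 2 * cnt1 n M S b.1.2 b.1 : ℝ) : ℂ))
      = Matrix.diagonal (fun b : {b // starReg n M S b} => (((n : ℝ) ^ 2 * bdW n M S (fun _ => 1) b.1 : ℝ) : ℂ)) := by
    congr 1
    funext b
    rw [cnt1_own_eq_bdW n M S hn b]
  rw [e]
  abel

/-- the same delta read against the electric operator: `(Lap)_{VV} = Δ_loc(0) − C + diag(n²·bdW 1)` (`2 ≤ n`). [folklore] -/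
theorem Lap_submatrix_eq_loc_sub_cornerC_add_bdMass (hn : 2 ≤ n) :
    (Lap n M).submatrix (Subtype.val : {b // starReg n M S b} → _) Subtype.val
      = regionDeltaLoc n M 0 S - cornerC n M S
          + Matrix.diagonal (fun b : {b // starReg n M S b} => (((n : ℝ) ^ 2 * bdW n M S (fun _ => 1) b.1 : ℝ) : ℂ)) := by
  rw [Lap_submatrix_eq_dir_add_bdMass n M S hn, regionDeltaLoc_eq, zero_mul, Complex.ofReal_zero, zero_smul, add_zero, electric_general]
  abel

end Region

end Summit.QuantumFields.BalabanUV.T4Continuum.RegionLiteralCompression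

end
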